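import Mathlib
import Summits.Ventures.PercRepro2.SwOutShadowMultiRootAvoid
import Summits.Ventures.PercRepro2.SwOutMultiRootECube

/-!
# The decorated multi-root core cube: the cluster monotonicities (blind cell PercRepro2, night-4
g35, 2026-08-29; proofs/NIGHT4-G35.md §3)

The red cluster of a root is increasing in the cube point and the blue one decreasing — g34's
proofs, the units in place of the arms.  THE NEW LEMMAS are the two monotonicities of the clusters
of `l`: **`cluster_l_decoRealRR_anti`** (the red cluster of `l` is decreasing in the cube point)
and **`cluster_blue_l_decoRealRR_mono`** — these are where the decorations bite.  A red path from
`l` at `ω'` visits `l`, the outside, the `false` arms and the decorations; the units that are `true`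
at `ω'` and `false` at a smaller `ω` change colour, and the path may enter their decorations by a
red edge at `l`.  But a decoration vertex of a unit assigned `false` lies in the red cluster of `l`
by its route (`deco_mem_cluster_l_of_false`), and a red path from `l` that avoids such decorations
is coloured alike at `ω` and at `ω'` — so the set of vertices of the red cluster of `l` at `ω`
together with the decorations of the changing units is closed under red adjacency at `ω'`.
-/

namespace Summit.Ventures.PercRepro2

namespace LocRows

open Hull

variable {V : Type*} {E : Type*}

open scoped Classical

variable {ends : E → Sym2 V}

section Cube

variable {ι : Type*} {A Z : ι → Set V} {ζ : Config E} {R H : Set V} {l : V} {RR : Finset E}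
  (hb : DecoBaseE ends ζ R H l A Z RR)
include hb

omit hb in
/-- An edge touching the units has an end in some unit. -/
lemma DecoBaseE.exists_unit_of_touches {e : E} (he : e ∈ touches ends (allArms (unitAZ A Z))) :
    ∃ i x y, ends e = s(x, y) ∧ x ∈ unitAZ A Z i := by
  obtain ⟨x, ⟨i, hx⟩, y, hxy⟩ := he
  exact ⟨i, x, y, hxy, hx⟩

omit hb in
/-- Two booleans in order that are not `false ≤ true` are equal. -/
lemma DecoBaseE.bool_eq_of_le_of_not {a b : Bool} (hab : a ≤ b) (h : ¬ (a = false ∧ b = true)) :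
    a = b := by
  cases a <;> cases b <;> first | rfl | exact absurd ⟨rfl, rfl⟩ h | exact absurd hab (by decide)

/-- Two cube points agreeing on the unit of an end of an edge (and on the edge, if it joins two
roots) colour that edge alike. -/
lemma DecoBaseE.decoRealRR_eq_of_agree {ω ω' : Config (ι ⊕ ↥RR)} {e : E}
    (hag : ∀ i, (∃ x ∈ unitAZ A Z i, x ∈ ends e) → ω (Sum.inl i) = ω' (Sum.inl i))
    (hrr : ∀ he : e ∈ RR, ω (Sum.inr ⟨e, he⟩) = ω' (Sum.inr ⟨e, he⟩)) :
    decoRealRR ends A Z RR ζ ω e = decoRealRR ends A Z RR ζ ω' e := by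
  by_cases he : e ∈ RR
  · rw [decoRealRR_apply_rr he, decoRealRR_apply_rr he, hrr he]
  by_cases ht : e ∈ touches ends (allArms (unitAZ A Z))
  · obtain ⟨i, x, y, hxy, hx⟩ := DecoBaseE.exists_unit_of_touches ht
    rw [hb.decoRealRR_apply_of_mem hxy hx, hb.decoRealRR_apply_of_mem hxy hx,
      hag i ⟨x, hx, by rw [hxy]; exact Sym2.mem_mk_left x y⟩]
  · rw [DecoBaseE.decoRealRR_apply_of_notMem ht he, DecoBaseE.decoRealRR_apply_of_notMem ht he]

/-- A vertex of `R ∪ armsTrueC ω` is no root once it lies in a unit; its unit is `true`. -/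
lemma DecoBaseE.unit_of_mem_true {ω : Config ι} {z : V} {i : ι}
    (hz : z ∈ R ∪ armsTrueC A ω) (hzi : z ∈ unitAZ A Z i) : ω i = true := by
  rcases hz with hz | ⟨j, hj, hz⟩
  · exact absurd hzi (hb.root_notMem_unit hz i)
  · rcases hzi with hzi | hzi
    · have hji : j = i := by
        by_contra hne
        exact hb.base.arm_disj j i hne z hz hzi
      rw [← hji]; exact hj
    · exact absurd hz (hb.deco_notMem_arm hzi)

/-- The unit of a vertex of `R ∪ armsFalseC ω` is `false`. -/
lemma DecoBaseE.unit_of_mem_false {ω : Config ι} {z : V} {i : ι}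
    (hz : z ∈ R ∪ armsFalseC A ω) (hzi : z ∈ unitAZ A Z i) : ω i = false := by
  rcases hz with hz | ⟨j, hj, hz⟩
  · exact absurd hzi (hb.root_notMem_unit hz i)
  · rcases hzi with hzi | hzi
    · have hji : j = i := by
        by_contra hne
        exact hb.base.arm_disj j i hne z hz hzi
      rw [← hji]; exact hj
    · exact absurd hz (hb.deco_notMem_arm hzi)

/-- A vertex outside `H` or in a `false` arm is no root. -/
lemma DecoBaseE.notMem_R_of_mem_out_false {ω : Config ι} {z : V}
    (hz : z ∈ Hᶜ ∪ armsFalseC A ω) : z ∉ R := by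
  rintro hzR
  rcases hz with hz | ⟨i, -, hz⟩
  · exact hz (hb.base.root_sub hzR)
  · exact hb.base.root_notMem_arm hzR i hz

/-- A vertex outside `H` or in a `true` arm is no root. -/
lemma DecoBaseE.notMem_R_of_mem_out_true {ω : Config ι} {z : V}
    (hz : z ∈ Hᶜ ∪ armsTrueC A ω) : z ∉ R := by
  rintro hzR
  rcases hz with hz | ⟨i, -, hz⟩
  · exact hz (hb.base.root_sub hzR)
  · exact hb.base.root_notMem_arm hzR i hz

/-- An edge with an end that is no root is no root–root edge. -/
lemma DecoBaseE.notMem_rr_of_notMem_R {e : E} {x y : V} (hxy : ends e = s(x, y)) (hx : x ∉ R) :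
    e ∉ RR := by
  intro he
  obtain ⟨r, hr, r', hr', hrr⟩ := (hb.base.rr_iff e).1 he
  rw [hxy, Sym2.eq_iff] at hrr
  rcases hrr with ⟨rfl, -⟩ | ⟨rfl, -⟩
  · exact hx hr
  · exact hx hr'

/-- A red edge inside `R ∪ armsTrueC ω` is red at every `ω' ≥ ω`. -/
lemma DecoBaseE.decoRealRR_le_of_within_true {ω ω' : Config (ι ⊕ ↥RR)} (hω : ω ≤ ω') {e : E}
    (he : e ∈ within ends (R ∪ armsTrueC A (armPart ω)))
    (hred : decoRealRR ends A Z RR ζ ω e = true) : decoRealRR ends A Z RR ζ ω' e = true := by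
  by_cases hrr : e ∈ RR
  · rw [hb.decoRealRR_rr_edge hrr] at hred ⊢
    have := hω (Sum.inr ⟨e, hrr⟩); rw [hred] at this; exact Bool.eq_true_of_true_le this
  · rw [← hred]
    refine (hb.decoRealRR_eq_of_agree (fun i ⟨x, hx, hxe⟩ => ?_) (fun h' => absurd h' hrr)).symm
    obtain ⟨a, ha, b, hb', hab⟩ := he
    rw [hab, Sym2.mem_iff] at hxe
    have hi : armPart ω i = true := by
      rcases hxe with rfl | rfl
      · exact hb.unit_of_mem_true ha hx
      · exact hb.unit_of_mem_true hb' hx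
    have hi' : ω' (Sum.inl i) = true := by
      have := hω (Sum.inl i); simp only [armPart] at hi; rw [hi] at this
      exact Bool.eq_true_of_true_le this
    simp only [armPart] at hi
    rw [hi, hi']

/-- A blue edge inside `R ∪ armsFalseC ω'` is blue at every `ω ≤ ω'`. -/
lemma DecoBaseE.decoRealRR_blue_of_within_false {ω ω' : Config (ι ⊕ ↥RR)} (hω : ω ≤ ω') {e : E}
    (he : e ∈ within ends (R ∪ armsFalseC A (armPart ω')))
    (hblue : decoRealRR ends A Z RR ζ ω' e = false) : decoRealRR ends A Z RR ζ ω e = false := by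
  by_cases hrr : e ∈ RR
  · have h1 := hb.decoRealRR_rr_edge (ω := ω') hrr
    have h2 := hb.decoRealRR_rr_edge (ω := ω) hrr
    have hω'' : ω' (Sum.inr ⟨e, hrr⟩) = false := by
      by_contra h'; rw [Bool.not_eq_false] at h'; rw [h1.2 h'] at hblue; simp at hblue
    have hω₀ : ω (Sum.inr ⟨e, hrr⟩) = false := by
      have := hω (Sum.inr ⟨e, hrr⟩); rw [hω''] at this; exact Bool.eq_false_of_le_false this
    by_contra h'; rw [Bool.not_eq_false] at h'
    rw [h2.1 h'] at hω₀; simp at hω₀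
  · rw [← hblue]
    refine hb.decoRealRR_eq_of_agree (fun i ⟨x, hx, hxe⟩ => ?_) (fun h' => absurd h' hrr)
    obtain ⟨a, ha, b, hb', hab⟩ := he
    rw [hab, Sym2.mem_iff] at hxe
    have hi' : armPart ω' i = false := by
      rcases hxe with rfl | rfl
      · exact hb.unit_of_mem_false ha hx
      · exact hb.unit_of_mem_false hb' hx
    simp only [armPart] at hi'
    have hi : ω (Sum.inl i) = false := by
      have := hω (Sum.inl i); rw [hi'] at this; exact Bool.eq_false_of_le_false this
    rw [hi, hi']

/-! ### The monotonicities of the roots' clusters -/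

/-- The red cluster of a root is increasing in the cube point. -/
theorem DecoBaseE.cluster_decoRealRR_mono {r : V} (hr : r ∈ R) {ω ω' : Config (ι ⊕ ↥RR)}
    (hω : ω ≤ ω') :
    cluster ends (decoRealRR ends A Z RR ζ ω) r ⊆ cluster ends (decoRealRR ends A Z RR ζ ω') r :=
  cluster_subset_of_le_within (S := R ∪ armsTrueC A (armPart ω))
    (fun _ hx _ hxy => hb.red_closed ω hx hxy) (Or.inl hr)
    (fun _ he hred => hb.decoRealRR_le_of_within_true hω he hred)

/-- The blue cluster of a root is decreasing in the cube point. -/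
theorem DecoBaseE.cluster_blue_decoRealRR_anti {r : V} (hr : r ∈ R) {ω ω' : Config (ι ⊕ ↥RR)}
    (hω : ω ≤ ω') :
    cluster ends (blue (decoRealRR ends A Z RR ζ ω')) r ⊆
      cluster ends (blue (decoRealRR ends A Z RR ζ ω)) r :=
  cluster_subset_of_le_within (S := R ∪ armsFalseC A (armPart ω'))
    (fun _ hx _ hxy => hb.blue_closed ω' hx hxy) (Or.inl hr)
    (fun e he hblue => by
      rw [blue_eq_true_iff] at hblue ⊢
      exact hb.decoRealRR_blue_of_within_false hω he hblue)

/-! ### The monotonicities of the clusters of `l` -/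

/-- The units assigned `false` by `ω` and `true` by `ω'`. -/
def DecoBaseE.changing (ω ω' : Config (ι ⊕ ↥RR)) (i : ι) : Prop :=
  ω (Sum.inl i) = false ∧ ω' (Sum.inl i) = true

omit hb in
/-- A unit that does not change keeps its coordinate between two ordered cube points. -/
lemma DecoBaseE.coord_eq_of_not_changing {ω ω' : Config (ι ⊕ ↥RR)} (hω : ω ≤ ω') {i : ι}
    (h : ¬ DecoBaseE.changing ω ω' i) : ω (Sum.inl i) = ω' (Sum.inl i) :=
  DecoBaseE.bool_eq_of_le_of_not (hω (Sum.inl i)) h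

/-- An edge whose ends avoid the decorations of the changing units and lie outside `H` or in
arms that are `false` at `ω'` is coloured alike at `ω ≤ ω'`. -/
lemma DecoBaseE.decoRealRR_eq_of_out_false {ω ω' : Config (ι ⊕ ↥RR)} (hω : ω ≤ ω') {e : E}
    {x y : V} (hxy : ends e = s(x, y)) (hx : x ∈ Hᶜ ∪ armsFalseC A (armPart ω'))
    (hy : y ∈ Hᶜ ∪ armsFalseC A (armPart ω'))
    (hxD : ¬ ∃ i, DecoBaseE.changing ω ω' i ∧ x ∈ Z i)
    (hyD : ¬ ∃ i, DecoBaseE.changing ω ω' i ∧ y ∈ Z i) :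
    decoRealRR ends A Z RR ζ ω e = decoRealRR ends A Z RR ζ ω' e := by
  have hrr : e ∉ RR := hb.notMem_rr_of_notMem_R hxy (hb.notMem_R_of_mem_out_false hx)
  refine hb.decoRealRR_eq_of_agree (fun j ⟨z, hz, hze⟩ => ?_) (fun h' => absurd h' hrr)
  rw [hxy, Sym2.mem_iff] at hze
  have key : ∀ w, w ∈ Hᶜ ∪ armsFalseC A (armPart ω') →
      (¬ ∃ i, DecoBaseE.changing ω ω' i ∧ w ∈ Z i) → w ∈ unitAZ A Z j →
        ω (Sum.inl j) = ω' (Sum.inl j) := by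
    rintro w hw hwD (hwA | hwZ)
    · have hj' : armPart ω' j = false := by
        rcases hw with hw | ⟨k, hk, hwk⟩
        · exact absurd (hb.base.arm_sub j w hwA).1 hw
        · have hkj : k = j := by
            by_contra hne
            exact hb.base.arm_disj k j hne w hwk hwA
          rw [← hkj]; exact hk
      simp only [armPart] at hj'
      have hj : ω (Sum.inl j) = false := by
        have := hω (Sum.inl j); rw [hj'] at this; exact Bool.eq_false_of_le_false this
      rw [hj, hj']
    · exact DecoBaseE.coord_eq_of_not_changing hω (fun hc => hwD ⟨j, hc, hwZ⟩)
  rcases hze with rfl | rfl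
  · exact key z hx hxD hz
  · exact key z hy hyD hz

/-- An edge whose ends avoid the decorations of the changing units and lie outside `H` or in
arms that are `true` at `ω` is coloured alike at `ω ≤ ω'`. -/
lemma DecoBaseE.decoRealRR_eq_of_out_true {ω ω' : Config (ι ⊕ ↥RR)} (hω : ω ≤ ω') {e : E}
    {x y : V} (hxy : ends e = s(x, y)) (hx : x ∈ Hᶜ ∪ armsTrueC A (armPart ω))
    (hy : y ∈ Hᶜ ∪ armsTrueC A (armPart ω))
    (hxD : ¬ ∃ i, DecoBaseE.changing ω ω' i ∧ x ∈ Z i)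
    (hyD : ¬ ∃ i, DecoBaseE.changing ω ω' i ∧ y ∈ Z i) :
    decoRealRR ends A Z RR ζ ω e = decoRealRR ends A Z RR ζ ω' e := by
  have hrr : e ∉ RR := hb.notMem_rr_of_notMem_R hxy (hb.notMem_R_of_mem_out_true hx)
  refine hb.decoRealRR_eq_of_agree (fun j ⟨z, hz, hze⟩ => ?_) (fun h' => absurd h' hrr)
  rw [hxy, Sym2.mem_iff] at hze
  have key : ∀ w, w ∈ Hᶜ ∪ armsTrueC A (armPart ω) →
      (¬ ∃ i, DecoBaseE.changing ω ω' i ∧ w ∈ Z i) → w ∈ unitAZ A Z j →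
        ω (Sum.inl j) = ω' (Sum.inl j) := by
    rintro w hw hwD (hwA | hwZ)
    · have hj : armPart ω j = true := by
        rcases hw with hw | ⟨k, hk, hwk⟩
        · exact absurd (hb.base.arm_sub j w hwA).1 hw
        · have hkj : k = j := by
            by_contra hne
            exact hb.base.arm_disj k j hne w hwk hwA
          rw [← hkj]; exact hk
      simp only [armPart] at hj
      have hj' : ω' (Sum.inl j) = true := by
        have := hω (Sum.inl j); rw [hj] at this; exact Bool.eq_true_of_true_le this
      rw [hj, hj']
    · exact DecoBaseE.coord_eq_of_not_changing hω (fun hc => hwD ⟨j, hc, hwZ⟩)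
  rcases hze with rfl | rfl
  · exact key z hx hxD hz
  · exact key z hy hyD hz

/-- **The red cluster of `l` is decreasing in the cube point.** -/
theorem DecoBaseE.cluster_l_decoRealRR_anti {ω ω' : Config (ι ⊕ ↥RR)} (hω : ω ≤ ω') :
    cluster ends (decoRealRR ends A Z RR ζ ω') l ⊆ cluster ends (decoRealRR ends A Z RR ζ ω) l := by
  -- the closure set at `ω'`: the red cluster of `l` at `ω` together with the decorations of the
  -- changing units
  let Q : Set V := {x | (x ∈ Hᶜ ∪ armsFalseC A (armPart ω') ∧
    x ∈ cluster ends (decoRealRR ends A Z RR ζ ω) l) ∨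
    ∃ i, DecoBaseE.changing ω ω' i ∧ x ∈ Z i}
  have hQsub : Q ⊆ cluster ends (decoRealRR ends A Z RR ζ ω) l := by
    rintro x (⟨-, hx⟩ | ⟨i, hi, hx⟩)
    · exact hx
    · exact hb.deco_mem_cluster_l_of_false hi.1 hx
  intro x hx
  refine hQsub (mem_of_conn_of_closed (ends := ends) (ω := decoRealRR ends A Z RR ζ ω') ?_
    (Or.inl ⟨Or.inl hb.l_notMem, mem_cluster_self _ _ _⟩) hx)
  intro x hx y hxy
  have hxS : x ∈ Hᶜ ∪ armsFalseC A (armPart ω') := by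
    rcases hx with ⟨hxS, -⟩ | ⟨i, -, hxi⟩
    · exact hxS
    · exact Or.inl (hb.deco_notMem i x hxi)
  have hyS : y ∈ Hᶜ ∪ armsFalseC A (armPart ω') := hb.red_closed_out ω' hxS hxy
  by_cases hyD : ∃ i, DecoBaseE.changing ω ω' i ∧ y ∈ Z i
  · exact Or.inr hyD
  refine Or.inl ⟨hyS, ?_⟩
  obtain ⟨_, e, he, hxy'⟩ := exists_edge_of_adj hxy
  by_cases hxD : ∃ i, DecoBaseE.changing ω ω' i ∧ x ∈ Z i
  · -- the edge leaves a decoration of a changing unit: to `l` (the arm is blue-attached at `ω'`)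
    obtain ⟨i, hi, hxi⟩ := hxD
    rcases hb.deco_edges i e x y hxy' hxi with hyA | hyZ | rfl
    · exfalso
      have := (hb.decoRealRR_out_edge (ends_swap hxy') hyA (hb.deco_notMem i x hxi)).1 he
      rw [hi.2] at this; exact absurd this (by decide)
    · exact absurd ⟨i, hi, hyZ⟩ hyD
    · exact mem_cluster_self _ _ _
  · have hxl : x ∈ cluster ends (decoRealRR ends A Z RR ζ ω) l := by
      rcases hx with ⟨-, hxl⟩ | ⟨i, hi, hxi⟩
      · exact hxl
      · exact absurd ⟨i, hi, hxi⟩ hxD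
    have hred : decoRealRR ends A Z RR ζ ω e = true := by
      rw [hb.decoRealRR_eq_of_out_false hω hxy' hxS hyS hxD hyD]; exact he
    exact mem_cluster_of_edge hxl hred hxy'

/-- **The blue cluster of `l` is increasing in the cube point.** -/
theorem DecoBaseE.cluster_blue_l_decoRealRR_mono {ω ω' : Config (ι ⊕ ↥RR)} (hω : ω ≤ ω') :
    cluster ends (blue (decoRealRR ends A Z RR ζ ω)) l ⊆
      cluster ends (blue (decoRealRR ends A Z RR ζ ω')) l := by
  let Q : Set V := {x | (x ∈ Hᶜ ∪ armsTrueC A (armPart ω) ∧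
    x ∈ cluster ends (blue (decoRealRR ends A Z RR ζ ω')) l) ∨
    ∃ i, DecoBaseE.changing ω ω' i ∧ x ∈ Z i}
  have hQsub : Q ⊆ cluster ends (blue (decoRealRR ends A Z RR ζ ω')) l := by
    rintro x (⟨-, hx⟩ | ⟨i, hi, hx⟩)
    · exact hx
    · exact hb.deco_mem_cluster_blue_l_of_true hi.2 hx
  intro x hx
  refine hQsub (mem_of_conn_of_closed (ends := ends) (ω := blue (decoRealRR ends A Z RR ζ ω)) ?_
    (Or.inl ⟨Or.inl hb.l_notMem, mem_cluster_self _ _ _⟩) hx)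
  intro x hx y hxy
  have hxS : x ∈ Hᶜ ∪ armsTrueC A (armPart ω) := by
    rcases hx with ⟨hxS, -⟩ | ⟨i, -, hxi⟩
    · exact hxS
    · exact Or.inl (hb.deco_notMem i x hxi)
  have hyS : y ∈ Hᶜ ∪ armsTrueC A (armPart ω) := hb.blue_closed_out ω hxS hxy
  by_cases hyD : ∃ i, DecoBaseE.changing ω ω' i ∧ y ∈ Z i
  · exact Or.inr hyD
  refine Or.inl ⟨hyS, ?_⟩
  obtain ⟨_, e, he, hxy'⟩ := exists_edge_of_adj hxy
  rw [blue_eq_true_iff] at he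
  by_cases hxD : ∃ i, DecoBaseE.changing ω ω' i ∧ x ∈ Z i
  · -- the edge leaves a decoration of a changing unit: to `l` (the arm is red-attached at `ω`)
    obtain ⟨i, hi, hxi⟩ := hxD
    rcases hb.deco_edges i e x y hxy' hxi with hyA | hyZ | rfl
    · exfalso
      have := hb.decoRealRR_out_edge (ω := ω) (ends_swap hxy') hyA (hb.deco_notMem i x hxi)
      rw [this.2 hi.1] at he; exact absurd he (by decide)
    · exact absurd ⟨i, hi, hyZ⟩ hyD
    · exact mem_cluster_self _ _ _
  · have hxl : x ∈ cluster ends (blue (decoRealRR ends A Z RR ζ ω')) l := by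
      rcases hx with ⟨-, hxl⟩ | ⟨i, hi, hxi⟩
      · exact hxl
      · exact absurd ⟨i, hi, hxi⟩ hxD
    have hblue : blue (decoRealRR ends A Z RR ζ ω') e = true := by
      rw [blue_eq_true_iff, ← hb.decoRealRR_eq_of_out_true hω hxy' hxS hyS hxD hyD]; exact he
    exact mem_cluster_of_edge hxl hblue hxy'

/-! ### Edges inside the clusters of `h` -/

/-- An edge inside the red cluster of a root at `ω` lies inside `R ∪ armsTrueC ω`. -/
lemma DecoBaseE.within_cluster_subset {r : V} (hr : r ∈ R) (ω : Config (ι ⊕ ↥RR)) :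
    within ends (cluster ends (decoRealRR ends A Z RR ζ ω) r) ⊆
      within ends (R ∪ armsTrueC A (armPart ω)) := by
  rintro e ⟨x, hx, y, hy, hxy⟩
  refine ⟨x, ?_, y, ?_, hxy⟩
  · rcases hb.mem_root_or_true_of_mem_cluster ω hr hx with h' | ⟨i, hi, hx'⟩
    · exact Or.inl h'
    · exact Or.inr ⟨i, hi, hx'⟩
  · rcases hb.mem_root_or_true_of_mem_cluster ω hr hy with h' | ⟨i, hi, hy'⟩
    · exact Or.inl h'
    · exact Or.inr ⟨i, hi, hy'⟩

/-- An edge inside the blue cluster of a root at `ω` lies inside `R ∪ armsFalseC ω`. -/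
lemma DecoBaseE.within_cluster_blue_subset {r : V} (hr : r ∈ R) (ω : Config (ι ⊕ ↥RR)) :
    within ends (cluster ends (blue (decoRealRR ends A Z RR ζ ω)) r) ⊆
      within ends (R ∪ armsFalseC A (armPart ω)) := by
  rintro e ⟨x, hx, y, hy, hxy⟩
  refine ⟨x, ?_, y, ?_, hxy⟩
  · rcases hb.mem_root_or_false_of_mem_cluster_blue ω hr hx with h' | ⟨i, hi, hx'⟩
    · exact Or.inl h'
    · exact Or.inr ⟨i, hi, hx'⟩
  · rcases hb.mem_root_or_false_of_mem_cluster_blue ω hr hy with h' | ⟨i, hi, hy'⟩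
    · exact Or.inl h'
    · exact Or.inr ⟨i, hi, hy'⟩

end Cube

end LocRows

end Summit.Ventures.PercRepro2
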